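import Literature.NumberTheory.Sieve.IwaniecAlmostPrimesQuadratic
import Literature.NumberTheory.Sieve.IwaniecAlmostPrimesWeightedSum
import HarnessLib

/-!
# Iwaniec (1978) for a general quadratic: inputs of the §6 evaluation of `W(𝒜_G, z)` — PROVED

Sequel to `IwaniecAlmostPrimesQuadratic.lean` (H. Iwaniec, Invent. Math. **47** (1978) 171–188
[cite: IwaniecInventiones1978, §6 pp. 186–187]; R. J. Lemke Oliver, Acta Arith. **151** (2012)
241–261 [cite: LemkeOliverActaArith2012, §2.3]), and the general-`G` counterpart of the first
sections of `IwaniecAlmostPrimesWeightedSum.lean` (which treats `n² + 1`).  That file evaluates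
`W(𝒜, z)` from identity (3), Proposition 2, two Mertens-type asymptotics for the local root count
`ρ`, and a tail bound; identity (3) for general `G` is `weightedSumG_eq` (previous file), and here
the remaining `G`-dependent elementary inputs are PROVED for every `G = aX² + bX + c` satisfying
Iwaniec's hypotheses (`a > 0`, `c` odd, `G` irreducible in `ℤ[X]`):

* `rhoG`, `densityProdG`: `ρ_G = polyRootCountMod ![G]` and `V_G(u) = ∏_{p < u} (1 − ρ_G(p)/p)`;
  `rhoG_le_two` (`ρ_G(p) ≤ 2`), `densityProdG_pos`;
* `tendsto_densityProdG_mul_log`: `V_G(z) log z → C(G) e^{−γ} = 2Γ_G e^{−γ}` ("Since `Γ_G ≠ 0`,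
  we have `V(z) ≫ log⁻¹ x` by Mertens' Theorem", Lemke Oliver p. 251; Iwaniec p. 187), from the
  tree's Bateman–Horn convergence theorem (`IsBatemanHornSystem.hasBatemanHornConst_holds`) for the
  system `{G}` (`isBatemanHornSystem_quadPoly`) and Mertens' product theorem;
* `rhoMertensG`, `rhoMertensG_below`: `∑_{p ≤ t} ρ_G(p)/p − log log t` converges (Kapoor's
  Lemma 14, there via Nagell), from Mertens' second theorem with its constant and the convergence
  of `∑_p (1 − ρ_G(p))/p` (`AZFG2020_tendsto_sum_sub_omega_div_holds`);
* `card_filter_dvd_le_fourG`, `sum_siftedCountG_le_four_mul`: the tail of (22) — a member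
  `|G(n)| ≤ X²` (`X = Kx`) has at most four prime factors `≥ X^{1/2}`, so
  `∑_{A ≤ p < X} S(𝒜_p, z) ≤ 4 S(𝒜, z)` for `A ≥ X^{1/2}`.

No named fact is introduced.  What §6 for general `G` still needs beyond this file is Lemke
Oliver's Lemma 5 (= Iwaniec's Proposition 2 for `𝒜_G`), and the `G`-independent partial-summation
and numerical layers of `IwaniecAlmostPrimesWeightedSum.lean` / `IwaniecAlmostPrimesNumerics.lean`
re-run with `ρ_G`.
-/

open Filter Finset Real Polynomial
open scoped Topology

noncomputable section

namespace Literature.NumberTheory.Sieve.Iwaniec1978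

variable {a b c : ℤ}

/-- `ρ_G(d)`, the number of `ν mod d` with `d ∣ G(ν)` (Iwaniec p. 171, Lemke Oliver p. 241), as
the tree's `polyRootCountMod` of the single polynomial `G`.
[cite: LemkeOliverActaArith2012, §1 p. 241] -/
def rhoG (a b c : ℤ) (d : ℕ) : ℕ := polyRootCountMod ![quadPoly a b c] d

/-- `V_G(u) = ∏_{p < u} (1 − ρ_G(p)/p)` (Lemke Oliver, Lemma 2; Iwaniec p. 175).
[cite: LemkeOliverActaArith2012, Lemma 2] -/
def densityProdG (a b c : ℤ) (u : ℝ) : ℝ :=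
  ∏ p ∈ Nat.primesBelow ⌈u⌉₊, (1 - (rhoG a b c p : ℝ) / p)

/-- **`ρ_G(p) ≤ 2` for every prime `p`** under Iwaniec's hypotheses: `G mod p` is a nonzero
polynomial of degree `≤ 2` over the field `ℤ/p` (it is not the zero polynomial because
`ρ_G(p) < p`, `polyRootCountMod_quadPoly_lt`). [cite: LemkeOliverActaArith2012, Remark 1 p. 242] -/
theorem rhoG_le_two (ha : 0 < a) (hc : Odd c) (hirr : Irreducible (quadPoly a b c)) {p : ℕ}
    (hp : p.Prime) : rhoG a b c p ≤ 2 := by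
  haveI := Fact.mk hp
  have hlt := polyRootCountMod_quadPoly_lt ha hc hirr hp
  unfold rhoG
  unfold polyRootCountMod at hlt ⊢
  simp only [Fin.prod_univ_one, Matrix.cons_val_fin_one, eval_quadPoly] at hlt ⊢
  set S := (Finset.range p).filter fun ν : ℕ => (p : ℤ) ∣ a * (ν : ℤ) ^ 2 + b * ν + c with hS
  set P : (ZMod p)[X] := C (a : ZMod p) * X ^ 2 + C (b : ZMod p) * X + C (c : ZMod p) with hP
  have hevalP : ∀ ν : ℕ, P.eval (ν : ZMod p) = ((a * (ν : ℤ) ^ 2 + b * ν + c : ℤ) : ZMod p) := by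
    intro ν
    rw [hP]
    push_cast
    simp only [eval_add, eval_mul, eval_C, eval_pow, eval_X]
  have hP0 : P ≠ 0 := by
    intro hP0
    apply hlt.ne
    have hSr : S = Finset.range p := by
      refine Finset.filter_true_of_mem fun ν _ => ?_
      rw [← ZMod.intCast_zmod_eq_zero_iff_dvd, ← hevalP, hP0, eval_zero]
    rw [hSr, Finset.card_range]
  have hmaps : ∀ ν ∈ S, ((ν : ZMod p)) ∈ P.roots.toFinset := by
    intro ν hν
    rw [Multiset.mem_toFinset, mem_roots hP0, IsRoot, hevalP]
    exact (ZMod.intCast_zmod_eq_zero_iff_dvd _ p).mpr (Finset.mem_filter.mp hν).2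
  have hinj : Set.InjOn (fun ν : ℕ => (ν : ZMod p)) S := by
    intro m hm n hn hmn
    have hm' := Finset.mem_range.mp (Finset.mem_filter.mp hm).1
    have hn' := Finset.mem_range.mp (Finset.mem_filter.mp hn).1
    have := (ZMod.natCast_eq_natCast_iff' m n p).mp hmn
    rwa [Nat.mod_eq_of_lt hm', Nat.mod_eq_of_lt hn'] at this
  calc S.card ≤ P.roots.toFinset.card := Finset.card_le_card_of_injOn _ hmaps hinj
    _ ≤ Multiset.card P.roots := Multiset.toFinset_card_le _
    _ ≤ P.natDegree := card_roots' P
    _ ≤ 2 := natDegree_quadratic_le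

/-- **`V_G(z) log z → C(G) e^{−γ}`**, `C(G) = batemanHornConst ![G] = 2Γ_G` (Lemke Oliver p. 251:
"`V(z) ≫ log⁻¹ x` by Mertens' Theorem"; Iwaniec p. 187) — PROVED from the tree's Bateman–Horn
convergence for the system `{G}` and Mertens' product theorem.
[cite: LemkeOliverActaArith2012, §2.3 p. 251] -/
theorem tendsto_densityProdG_mul_log (ha : 0 < a) (hc : Odd c)
    (hirr : Irreducible (quadPoly a b c)) :
    Tendsto (fun z : ℝ => densityProdG a b c z * Real.log z) atTop
      (𝓝 (batemanHornConst ![quadPoly a b c] * Real.exp (-Real.eulerMascheroniConstant))) := by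
  set f : Fin 1 → ℤ[X] := ![quadPoly a b c] with hf
  have hBH : Tendsto (batemanHornPartial f) atTop (𝓝 (batemanHornConst f)) :=
    (IsBatemanHornSystem.hasBatemanHornConst_holds (isBatemanHornSystem_quadPoly ha hc hirr)).1
  have hM := Literature.NumberTheory.LFunctions.Mertens.tendsto_log_mul_prod_one_sub_inv_nat
  have hfac : ∀ z : ℝ, densityProdG a b c z =
      batemanHornPartial f (ceilPred z) * ∏ p ∈ Nat.primesLE (ceilPred z), (1 - (p : ℝ)⁻¹) := by
    intro z
    rw [densityProdG, primesBelow_ceil, batemanHornPartial, ← Finset.prod_mul_distrib]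
    refine Finset.prod_congr rfl fun p hp => ?_
    have hpp : p.Prime := (Nat.mem_primesLE.mp hp).2
    have h1 : (1 - (p : ℝ)⁻¹) ≠ 0 := by
      rw [sub_ne_zero, ne_comm]
      exact (inv_lt_one_of_one_lt₀ (by exact_mod_cast hpp.one_lt)).ne
    rw [rhoG, ← hf, Fintype.card_fin, pow_one, one_div,
      mul_comm ((1 - (p : ℝ)⁻¹)⁻¹) _, mul_assoc, inv_mul_cancel₀ h1, mul_one]
  have hcomb : Tendsto (fun z : ℝ => batemanHornPartial f (ceilPred z) *
      (Real.log (ceilPred z) * ∏ p ∈ Nat.primesLE (ceilPred z), (1 - (p : ℝ)⁻¹)) *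
        (Real.log z / Real.log (ceilPred z))) atTop
      (𝓝 (batemanHornConst f * Real.exp (-Real.eulerMascheroniConstant) * 1)) :=
    ((hBH.comp tendsto_ceilPred).mul (hM.comp tendsto_ceilPred)).mul tendsto_log_div_log_ceilPred
  rw [mul_one] at hcomb
  refine hcomb.congr' ?_
  have hlogN : Tendsto (fun z : ℝ => Real.log (ceilPred z)) atTop atTop :=
    Real.tendsto_log_atTop.comp (tendsto_natCast_atTop_atTop.comp tendsto_ceilPred)
  filter_upwards [hlogN.eventually_gt_atTop 0] with z hz
  rw [hfac z]
  field_simp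

/-- The same limit in terms of `Γ_G`: `V_G(z) log z → 2Γ_G e^{−γ}` (the printed
`V(z) ∼ Γ_G e^{−C}(log z)⁻¹` of Iwaniec p. 187 drops the factor `g = 2`).
[cite: IwaniecInventiones1978, §6 p. 187] -/
theorem tendsto_densityProdG_mul_log' (ha : 0 < a) (hc : Odd c)
    (hirr : Irreducible (quadPoly a b c)) :
    Tendsto (fun z : ℝ => densityProdG a b c z * Real.log z) atTop
      (𝓝 (2 * gammaG a b c * Real.exp (-Real.eulerMascheroniConstant))) := by
  have h := tendsto_densityProdG_mul_log ha hc hirr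
  rwa [show batemanHornConst ![quadPoly a b c] = 2 * gammaG a b c by rw [gammaG]; ring] at h

/-- **`∑_{p ≤ t} ρ_G(p)/p = log log t + b_G + o(1)`** (the partial-summation input of §6; Kapoor
arXiv:1910.02885 Lemma 14 via Nagell's theorem) — PROVED from Mertens' second theorem with its
constant and the convergence of `∑_p (1 − ρ_G(p))/p` for the Bateman–Horn system `{G}`
(AZFG 2020 (5.4.4), proved in the tree). [cite: IwaniecInventiones1978, §6 p. 186] -/
theorem rhoMertensG (ha : 0 < a) (hc : Odd c) (hirr : Irreducible (quadPoly a b c)) :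
    ∃ b₀ : ℝ, Tendsto (fun t : ℝ =>
        ∑ p ∈ Nat.primesLE ⌊t⌋₊, (rhoG a b c p : ℝ) / p - Real.log (Real.log t)) atTop (𝓝 b₀) := by
  set f : Fin 1 → ℤ[X] := ![quadPoly a b c] with hf
  obtain ⟨L, hL⟩ := AZFG2020_tendsto_sum_sub_omega_div_holds 1 f
    (isBatemanHornSystem_quadPoly ha hc hirr)
  have hM := Literature.NumberTheory.LFunctions.Mertens.tendsto_primeRecipSum_sub_loglog
  refine ⟨Literature.NumberTheory.LFunctions.Mertens.meisselMertens - L, ?_⟩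
  have hdec : ∀ t : ℝ, ∑ p ∈ Nat.primesLE ⌊t⌋₊, (rhoG a b c p : ℝ) / p =
      Literature.NumberTheory.LFunctions.Mertens.primeRecipSum t -
        ∑ p ∈ Nat.primesLE ⌊t⌋₊, ((1 : ℕ) - (polyRootCountMod f p : ℝ)) / p := by
    intro t
    rw [Literature.NumberTheory.LFunctions.Mertens.primeRecipSum, ← Finset.sum_sub_distrib]
    refine Finset.sum_congr rfl fun p _ => ?_
    rw [rhoG, ← hf]
    push_cast
    ring
  have hfloor : Tendsto (fun t : ℝ => ⌊t⌋₊) atTop atTop := tendsto_nat_floor_atTop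
  have hcomb := hM.sub (hL.comp hfloor)
  refine hcomb.congr' (Eventually.of_forall fun t => ?_)
  simp only [Function.comp_apply, hdec t]
  ring

/-- The same along `{p < t}` (`Nat.primesBelow ⌈t⌉₊`, the indexing of `densityProdG`).
[cite: IwaniecInventiones1978, §6 p. 186] -/
theorem rhoMertensG_below (ha : 0 < a) (hc : Odd c) (hirr : Irreducible (quadPoly a b c)) :
    ∃ b₀ : ℝ, Tendsto (fun t : ℝ =>
        ∑ p ∈ Nat.primesBelow ⌈t⌉₊, (rhoG a b c p : ℝ) / p - Real.log (Real.log t))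
      atTop (𝓝 b₀) := by
  set f : Fin 1 → ℤ[X] := ![quadPoly a b c] with hf
  obtain ⟨L, hL⟩ := AZFG2020_tendsto_sum_sub_omega_div_holds 1 f
    (isBatemanHornSystem_quadPoly ha hc hirr)
  have hM := Literature.NumberTheory.LFunctions.Mertens.tendsto_primeRecipSum_sub_loglog
  refine ⟨Literature.NumberTheory.LFunctions.Mertens.meisselMertens - L, ?_⟩
  have hdec : ∀ t : ℝ, ∑ p ∈ Nat.primesBelow ⌈t⌉₊, (rhoG a b c p : ℝ) / p =
      Literature.NumberTheory.LFunctions.Mertens.primeRecipSum (ceilPred t) -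
        ∑ p ∈ Nat.primesLE (ceilPred t), ((1 : ℕ) - (polyRootCountMod f p : ℝ)) / p := by
    intro t
    rw [Literature.NumberTheory.LFunctions.Mertens.primeRecipSum, Nat.floor_natCast,
      primesBelow_ceil, ← Finset.sum_sub_distrib]
    refine Finset.sum_congr rfl fun p _ => ?_
    rw [rhoG, ← hf]
    push_cast
    ring
  have hll : Tendsto (fun t : ℝ => Real.log (Real.log (ceilPred t)) - Real.log (Real.log t))
      atTop (𝓝 0) := by
    have h1 : Tendsto (fun t : ℝ => Real.log (Real.log (ceilPred t) / Real.log t)) atTop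
        (𝓝 0) := by
      have hinv : Tendsto (fun t : ℝ => Real.log (ceilPred t) / Real.log t) atTop (𝓝 1) := by
        have := tendsto_log_div_log_ceilPred.inv₀ one_ne_zero
        rw [inv_one] at this
        exact this.congr fun t => by simp [inv_div]
      have h2 := (Real.continuousAt_log one_ne_zero).tendsto.comp hinv
      rw [Real.log_one] at h2
      exact h2
    refine h1.congr' ?_
    have hlogN : Tendsto (fun z : ℝ => Real.log (ceilPred z)) atTop atTop :=
      Real.tendsto_log_atTop.comp (tendsto_natCast_atTop_atTop.comp tendsto_ceilPred)
    filter_upwards [hlogN.eventually_gt_atTop 0,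
      (Real.tendsto_log_atTop).eventually_gt_atTop 0] with t h1 h2
    rw [Real.log_div h1.ne' h2.ne']
  have hcomb := ((hM.comp (tendsto_natCast_atTop_atTop.comp tendsto_ceilPred)).add hll).sub
    (hL.comp tendsto_ceilPred)
  rw [add_zero] at hcomb
  refine hcomb.congr' (Eventually.of_forall fun t => ?_)
  simp only [Function.comp_apply, hdec t]
  ring

/-- `V_G(z) > 0` for every `z`: each factor `1 − ρ_G(p)/p` is positive since `ρ_G(p) < p`.
[folklore] -/
theorem densityProdG_pos (ha : 0 < a) (hc : Odd c) (hirr : Irreducible (quadPoly a b c))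
    (u : ℝ) : 0 < densityProdG a b c u := by
  unfold densityProdG
  refine Finset.prod_pos fun p hp => ?_
  have hpp : p.Prime := (Nat.mem_primesBelow.mp hp).2
  have hlt : (rhoG a b c p : ℝ) < p := by
    exact_mod_cast polyRootCountMod_quadPoly_lt ha hc hirr hpp
  have hp0 : (0 : ℝ) < p := by exact_mod_cast hpp.pos
  rw [sub_pos, div_lt_one hp0]
  exact hlt

/-! ### The tail of (22) for general `G`: at most four prime factors `≥ X^{1/2}` -/

section TailG

variable {x : ℝ}

open scoped Classical in
/-- For `x > 1`, `1 ≤ n ≤ x` and `X = Kx`: at most four primes `p ≥ X^{1/2}` divide `|G(n)|`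
(their product divides `|G(n)| ≤ Kx² ≤ X² < X^{5/2}`; `G(n) ≠ 0` by irreducibility). [folklore] -/
theorem card_filter_dvd_le_fourG (ha : 0 < a) (hirr : Irreducible (quadPoly a b c))
    (hx : 1 < x) {n : ℕ} (hn : n ∈ Finset.Icc 1 ⌊x⌋₊) {A : ℝ}
    (hA : ((sizeK a b c : ℝ) * x) ^ (1 / 2 : ℝ) ≤ A) :
    ((primesIn A ((sizeK a b c : ℝ) * x)).filter (fun p : ℕ => p ∣ gAbs a b c n)).card ≤ 4 := by
  set Kr : ℝ := (sizeK a b c : ℝ) with hKr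
  have hK1 : 1 ≤ Kr := one_le_sizeK ha
  set Xs : ℝ := Kr * x with hXs
  have hXs1 : 1 < Xs := by rw [hXs]; nlinarith
  have hXs0 : 0 < Xs := by linarith
  set D := (primesIn A Xs).filter (fun p : ℕ => p ∣ gAbs a b c n) with hD
  by_contra hlt
  rw [not_le] at hlt
  have hx0 : 0 < x := by linarith
  have hsq : 1 ≤ Xs ^ (1 / 2 : ℝ) := Real.one_le_rpow hXs1.le (by norm_num)
  have hprime : ∀ p ∈ D, p.Prime := fun p hp => (mem_primesIn.mp (Finset.mem_filter.mp hp).1).1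
  have hdvd : ∀ p ∈ D, p ∣ gAbs a b c n := fun p hp => (Finset.mem_filter.mp hp).2
  have hge : ∀ p ∈ D, Xs ^ (1 / 2 : ℝ) ≤ (p : ℝ) := fun p hp =>
    hA.trans (mem_primesIn.mp (Finset.mem_filter.mp hp).1).2.1
  have hG0 : gAbs a b c n ≠ 0 := Int.natAbs_ne_zero.mpr (quadPoly_eval_ne_zero ha.ne' hirr n)
  have hprod : (∏ p ∈ D, p) ∣ gAbs a b c n :=
    Finset.prod_primes_dvd _ (fun p hp => (hprime p hp).prime) hdvd
  have hle : ((∏ p ∈ D, p : ℕ) : ℝ) ≤ (gAbs a b c n : ℝ) := by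
    exact_mod_cast Nat.le_of_dvd (Nat.pos_of_ne_zero hG0) hprod
  have hpow : (Xs ^ (1 / 2 : ℝ)) ^ D.card ≤ ((∏ p ∈ D, p : ℕ) : ℝ) := by
    rw [Nat.cast_prod]
    have h := Finset.prod_le_prod (s := D) (f := fun _ => Xs ^ (1 / 2 : ℝ))
      (g := fun p : ℕ => (p : ℝ)) (fun _ _ => by positivity) (fun p hp => hge p hp)
    rwa [Finset.prod_const] at h
  have h5 : (Xs ^ (1 / 2 : ℝ)) ^ 5 ≤ (Xs ^ (1 / 2 : ℝ)) ^ D.card :=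
    pow_le_pow_right₀ hsq hlt
  have hx52 : (Xs ^ (1 / 2 : ℝ)) ^ 5 = Xs ^ 2 * Xs ^ (1 / 2 : ℝ) := by
    rw [← Real.rpow_natCast, ← Real.rpow_mul hXs0.le]
    rw [show (1 / 2 : ℝ) * (5 : ℕ) = 2 + 1 / 2 by norm_num, Real.rpow_add hXs0, Real.rpow_two]
  have hnx : (n : ℝ) ≤ x := by
    have h1 : (n : ℝ) ≤ ⌊x⌋₊ := by exact_mod_cast (Finset.mem_Icc.mp hn).2
    exact h1.trans (Nat.floor_le hx0.le)
  have hGle : (gAbs a b c n : ℝ) ≤ Kr * x ^ 2 := gAbs_le ha hx.le hnx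
  -- `K x² ≤ X² < X² X^{1/2}`
  have hKX : Kr * x ^ 2 ≤ Xs ^ 2 := by
    rw [hXs, mul_pow]
    have : Kr ≤ Kr ^ 2 := by nlinarith
    have hx2 : 0 ≤ x ^ 2 := sq_nonneg x
    nlinarith
  have key : Xs ^ 2 < Xs ^ 2 * Xs ^ (1 / 2 : ℝ) := by
    have hX2 : 0 < Xs ^ 2 := by positivity
    have hs1 : 1 < Xs ^ (1 / 2 : ℝ) := Real.one_lt_rpow hXs1 (by norm_num)
    nlinarith
  linarith [hle, hpow, h5]

open scoped Classical in
/-- **Tail bound for §6 (22), general `G` — PROVED:** for `x > 1`, `X = Kx`, `X^{1/2} ≤ A`: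
`∑_{A ≤ p < X} S(𝒜_p, z) ≤ 4 S(𝒜, z)` (each sifted member is counted once for each of its at most
four prime factors `≥ X^{1/2}`). [cite: IwaniecInventiones1978, §6 (22)] -/
theorem sum_siftedCountG_le_four_mul (ha : 0 < a) (hirr : Irreducible (quadPoly a b c))
    (hx : 1 < x) {A : ℝ} (hA : ((sizeK a b c : ℝ) * x) ^ (1 / 2 : ℝ) ≤ A) (z : ℝ) :
    ∑ p ∈ primesIn A ((sizeK a b c : ℝ) * x), (siftedCountG a b c x p z : ℝ) ≤
      4 * siftedCountG a b c x 1 z := by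
  have h1 : ∀ p ∈ primesIn A ((sizeK a b c : ℝ) * x), (siftedCountG a b c x p z : ℝ) =
      ∑ n ∈ siftedSetG a b c x z, if p ∣ gAbs a b c n then (1 : ℝ) else 0 := by
    intro p _
    rw [Finset.sum_boole, siftedCountG, ← filter_dvd_siftedSetG]
  rw [Finset.sum_congr rfl h1, Finset.sum_comm, siftedCountG_one]
  have h2 : ∀ n ∈ siftedSetG a b c x z,
      (∑ p ∈ primesIn A ((sizeK a b c : ℝ) * x), if p ∣ gAbs a b c n then (1 : ℝ) else 0) ≤ 4 := by
    intro n hn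
    rw [Finset.sum_boole]
    have := card_filter_dvd_le_fourG ha hirr hx (mem_siftedSetG.mp hn).1 hA
    exact_mod_cast this
  calc ∑ n ∈ siftedSetG a b c x z,
        (∑ p ∈ primesIn A ((sizeK a b c : ℝ) * x), if p ∣ gAbs a b c n then (1 : ℝ) else 0)
      ≤ ∑ n ∈ siftedSetG a b c x z, (4 : ℝ) := Finset.sum_le_sum h2
    _ = 4 * (siftedSetG a b c x z).card := by rw [Finset.sum_const, nsmul_eq_mul, mul_comm]

end TailG

end Literature.NumberTheory.Sieve.Iwaniec1978

end
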